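import Literature.MeasureTheory.Moments.TruncatedMomentPositivity
import Literature.MeasureTheory.Moments.TruncatedMomentProblemProofs

/-!
# Order-3 surgery for `MomentParity.QuarticGate` (stmt-AnomalousDissipation-11464), helper II:
# strict positivity survives a third-moment shift once the fourth moments are inflated
# ("lambda-positivity")

Support file for the stub `stub_order3Surgery` of the line `recession-cone` (S5). In the
Fialkow–Nie vocabulary of `Literature/MeasureTheory/Moments/TruncatedMomentPositivity.lean`:
if `L_y` is strictly positive on the nonnegative polynomials of degree `≤ 4` on `ℝⁿ`, then for ANY
prescribed shift `S` of the degree-`3` entries, the sequence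
`y_λ = (y_{≤2}, y₃ + S, λ·y₄)` is again strictly positive for all large `λ`
(`exists_forall_le_isStrictlyKPositive_shift`). Proof (recession/compactness): a failing
nonnegative `p_λ`, normalised in the finite-dimensional coefficient space, subconverges to
`p* ≥ 0` with `L_y(p*₄) = 0`, hence `p*₄ = 0` (strict positivity; the top form of a nonnegative
polynomial is nonnegative), hence `p*₃ = 0` (a nonnegative polynomial has no odd top form), hence
`L_y(p*) = lim L_{y_λ}((p_λ)_{≤3}) ≤ 0`, contradicting strict positivity. Plus bookkeeping lemmas.
-/

-- `Summit.<Summit>.<Problem>` is the tree's mandated summit-side namespace (CONVENTIONS §2); for this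
-- single-conjunct summit the two coincide, so the duplicate is deliberate.
set_option linter.dupNamespace false

namespace Summit.AnomalousDissipation.AnomalousDissipation.Theorems.MomentParityQuarticGate

open scoped BigOperators Topology
open Filter MvPolynomial Literature.MeasureTheory.Moments

/-! ## Bookkeeping on the Fialkow–Nie vocabulary -/

/-- The degree `|α| = Σᵢ αᵢ` of an exponent in the form used by `MvPolynomial.totalDegree`.
[folklore] -/
theorem finsupp_degree_eq_sum {n : ℕ} (α : Fin n →₀ ℕ) : α.degree = α.sum fun _ e => e := by
  rw [Finsupp.degree_apply]
  rfl

/-- Over `K = ℝⁿ` the strict clause alone gives strict `K`-positivity: a nonnegative polynomial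
that vanishes identically is the zero polynomial, whose Riesz functional is `0`. [folklore] -/
theorem isStrictlyKPositive_univ_of {n k : ℕ} {y : (Fin n →₀ ℕ) → ℝ}
    (h : ∀ p : MvPolynomial (Fin n) ℝ, p.totalDegree ≤ k → (∀ x, 0 ≤ eval x p) →
      (∃ x, eval x p ≠ 0) → 0 < rieszFunctional y p) :
    IsStrictlyKPositive (Set.univ : Set (Fin n → ℝ)) k y := by
  refine ⟨fun p hp hnn => ?_, fun p hp hnn hex => ?_⟩
  · by_cases hex : ∃ x, eval x p ≠ 0
    · exact (h p hp (fun x => hnn x (Set.mem_univ x)) hex).le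
    · push Not at hex
      have hp0 : p = 0 := MvPolynomial.funext fun x => by rw [hex x, map_zero]
      simp [hp0, rieszFunctional]
  · obtain ⟨x, -, hx⟩ := hex
    exact h p hp (fun x => hnn x (Set.mem_univ x)) ⟨x, hx⟩

/-- The Riesz functional of a polynomial of degree `≤ k` only sees `y_α`, `|α| ≤ k`. [folklore] -/
theorem rieszFunctional_congr_of_totalDegree_le {n k : ℕ} {y y' : (Fin n →₀ ℕ) → ℝ}
    (h : ∀ α : Fin n →₀ ℕ, α.degree ≤ k → y α = y' α) {p : MvPolynomial (Fin n) ℝ}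
    (hp : p.totalDegree ≤ k) : rieszFunctional y p = rieszFunctional y' p := by
  unfold rieszFunctional
  refine Finset.sum_congr rfl fun α hα => ?_
  rw [h α ((finsupp_degree_eq_sum α).trans_le ((le_totalDegree hα).trans hp))]

/-- Strict `K`-positivity in degree `k` depends only on `y_α`, `|α| ≤ k`. [folklore] -/
theorem isStrictlyKPositive_congr {n k : ℕ} {K : Set (Fin n → ℝ)} {y y' : (Fin n →₀ ℕ) → ℝ}
    (h : ∀ α : Fin n →₀ ℕ, α.degree ≤ k → y α = y' α) (hy : IsStrictlyKPositive K k y) :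
    IsStrictlyKPositive K k y' :=
  ⟨fun p hp hnn => (rieszFunctional_congr_of_totalDegree_le h hp) ▸ hy.1 p hp hnn,
    fun p hp hnn hex => (rieszFunctional_congr_of_totalDegree_le h hp) ▸ hy.2 p hp hnn hex⟩

/-! ## Top forms of nonnegative polynomials (coefficient-vector form) -/

/-- If `a t^{k+1} + M t^k ≥ 0` for all `t ≥ 1` then `a ≥ 0`. [folklore] -/
theorem nonneg_of_forall_one_le {a M : ℝ} {k : ℕ}
    (h : ∀ t : ℝ, 1 ≤ t → 0 ≤ a * t ^ (k + 1) + M * t ^ k) : 0 ≤ a := by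
  by_contra ha
  push Not at ha
  set t : ℝ := (|M| + 1) / (-a) + 1 with ht
  have hna : 0 < -a := neg_pos.mpr ha
  have ht1 : 1 ≤ t := by
    rw [ht]
    have : 0 ≤ (|M| + 1) / (-a) := div_nonneg (by positivity) hna.le
    linarith
  have htpos : 0 < t := by linarith
  have hat : a * t + M < 0 := by
    have h1' : (-a) * ((|M| + 1) / (-a)) = |M| + 1 := mul_div_cancel₀ _ hna.ne'
    have h1 : a * ((|M| + 1) / (-a)) = -(|M| + 1) := by linarith
    have h2 : a * t = -(|M| + 1) + a := by rw [ht, mul_add, h1, mul_one]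
    rw [h2]
    linarith [le_abs_self M]
  have key := h t ht1
  have hfac : a * t ^ (k + 1) + M * t ^ k = t ^ k * (a * t + M) := by ring
  rw [hfac] at key
  have := (mul_pos_iff_of_pos_left (pow_pos htpos k)).mp
    (lt_of_le_of_ne key (fun h0 => by
      rw [eq_comm, mul_eq_zero] at h0
      rcases h0 with h0 | h0
      · exact (pow_pos htpos k).ne' h0
      · exact hat.ne h0))
  linarith

/-- Homogeneity of monomials: `(t x)^α = t^{|α|} x^α`. [folklore] -/
theorem prod_mul_pow_eq {n : ℕ} (t : ℝ) (x : Fin n → ℝ) (α : Fin n →₀ ℕ) :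
    ∏ i, (t * x i) ^ α i = t ^ α.degree * ∏ i, x i ^ α i := by
  simp_rw [mul_pow]
  rw [Finset.prod_mul_distrib, Finset.prod_pow_eq_pow_sum, Finsupp.degree_eq_sum]

/-- The degree-`4` part of a nonnegative polynomial of degree `≤ 4` is nonnegative (coefficient
vectors over a finite set `T` of exponents of degree `≤ 4`): look at `p(tx)/t⁴`, `t → ∞`.
[folklore] -/
theorem degFour_nonneg {n : ℕ} {T : Finset (Fin n →₀ ℕ)} (hT : ∀ α : ↥T, α.1.degree ≤ 4)
    (c : ↥T → ℝ) (hc : ∀ x : Fin n → ℝ, 0 ≤ c ⬝ᵥ fun α : ↥T => ∏ i, x i ^ (α.1 i))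
    (x : Fin n → ℝ) :
    0 ≤ (fun α : ↥T => if α.1.degree = 4 then c α else 0) ⬝ᵥ fun α : ↥T => ∏ i, x i ^ (α.1 i) := by
  classical
  refine nonneg_of_forall_one_le (k := 3) (M := ∑ α : ↥T, |c α * ∏ i, x i ^ (α.1 i)|) ?_
  intro t ht
  have ht0 : 0 ≤ t := zero_le_one.trans ht
  have key := hc (fun i => t * x i)
  simp only [dotProduct, prod_mul_pow_eq] at key ⊢
  rw [Finset.sum_mul, Finset.sum_mul, ← Finset.sum_add_distrib]
  refine key.trans (Finset.sum_le_sum fun α _ => ?_)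
  have hle : c α * (t ^ α.1.degree * ∏ i, x i ^ (α.1 i)) ≤
      |c α * ∏ i, x i ^ (α.1 i)| * t ^ α.1.degree := by
    rw [mul_left_comm, mul_comm]
    exact (le_abs_self _).trans_eq (by rw [abs_mul, abs_of_nonneg (pow_nonneg ht0 _), mul_comm])
  split_ifs with h4
  · rw [h4]
    have e : c α * (t ^ 4 * ∏ i, x i ^ (α.1 i)) = (c α * ∏ i, x i ^ (α.1 i)) * t ^ (3 + 1) := by
      ring
    have : 0 ≤ |c α * ∏ i, x i ^ (α.1 i)| * t ^ 3 := by positivity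
    rw [e]
    linarith
  · have h3 : α.1.degree ≤ 3 := by
      have := hT α
      omega
    have hpow : t ^ α.1.degree ≤ t ^ 3 := pow_le_pow_right₀ ht h3
    simp only [zero_mul, zero_add]
    exact hle.trans (mul_le_mul_of_nonneg_left hpow (abs_nonneg _))

/-- If a nonnegative polynomial of degree `≤ 4` has no degree-`4` part, its degree-`3` part
vanishes identically (an odd top form changes sign under `x ↦ -x`). [folklore] -/
theorem degThree_eq_zero {n : ℕ} {T : Finset (Fin n →₀ ℕ)} (hT : ∀ α : ↥T, α.1.degree ≤ 4)
    (c : ↥T → ℝ) (hc : ∀ x : Fin n → ℝ, 0 ≤ c ⬝ᵥ fun α : ↥T => ∏ i, x i ^ (α.1 i))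
    (h4 : ∀ α : ↥T, α.1.degree = 4 → c α = 0) (x : Fin n → ℝ) :
    (fun α : ↥T => if α.1.degree = 3 then c α else 0) ⬝ᵥ (fun α : ↥T => ∏ i, x i ^ (α.1 i)) = 0 := by
  classical
  -- nonnegativity of the cubic part at every point
  have hnn : ∀ z : Fin n → ℝ,
      0 ≤ (fun α : ↥T => if α.1.degree = 3 then c α else 0) ⬝ᵥ fun α : ↥T => ∏ i, z i ^ (α.1 i) := by
    intro z
    refine nonneg_of_forall_one_le (k := 2) (M := ∑ α : ↥T, |c α * ∏ i, z i ^ (α.1 i)|) ?_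
    intro t ht
    have ht0 : 0 ≤ t := zero_le_one.trans ht
    have key := hc (fun i => t * z i)
    simp only [dotProduct, prod_mul_pow_eq] at key ⊢
    rw [Finset.sum_mul, Finset.sum_mul, ← Finset.sum_add_distrib]
    refine key.trans (Finset.sum_le_sum fun α _ => ?_)
    have hle : c α * (t ^ α.1.degree * ∏ i, z i ^ (α.1 i)) ≤
        |c α * ∏ i, z i ^ (α.1 i)| * t ^ α.1.degree := by
      rw [mul_left_comm, mul_comm]
      exact (le_abs_self _).trans_eq (by rw [abs_mul, abs_of_nonneg (pow_nonneg ht0 _), mul_comm])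
    split_ifs with h3
    · rw [h3]
      have e : c α * (t ^ 3 * ∏ i, z i ^ (α.1 i)) = (c α * ∏ i, z i ^ (α.1 i)) * t ^ (2 + 1) := by
        ring
      have : 0 ≤ |c α * ∏ i, z i ^ (α.1 i)| * t ^ 2 := by positivity
      rw [e]
      linarith
    · simp only [zero_mul, zero_add]
      by_cases h4' : α.1.degree = 4
      · rw [h4 α h4', zero_mul, zero_mul, abs_zero, zero_mul]
      · have h2 : α.1.degree ≤ 2 := by
          have := hT α
          omega
        exact hle.trans (mul_le_mul_of_nonneg_left (pow_le_pow_right₀ ht h2) (abs_nonneg _))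
  -- the cubic part is odd
  have hodd : (fun α : ↥T => if α.1.degree = 3 then c α else 0) ⬝ᵥ
      (fun α : ↥T => ∏ i, (fun i => (-1 : ℝ) * x i) i ^ (α.1 i)) =
      -((fun α : ↥T => if α.1.degree = 3 then c α else 0) ⬝ᵥ fun α : ↥T => ∏ i, x i ^ (α.1 i)) := by
    simp only [dotProduct, prod_mul_pow_eq, ← Finset.sum_neg_distrib]
    refine Finset.sum_congr rfl fun α _ => ?_
    split_ifs with h3
    · rw [h3]
      ring
    · simp
  have h1 := hnn (fun i => (-1 : ℝ) * x i)
  rw [hodd] at h1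
  exact le_antisymm (by linarith) (hnn x)

/-! ## The main lemma -/

/-- **Lambda-positivity.** Let `L_y` be strictly positive on nonnegative polynomials of degree
`≤ 4` on `ℝⁿ` (`IsStrictlyKPositive univ 4 y`) and let `S` be any real sequence (only its
degree-`3` entries matter). Then for all sufficiently large `λ` the sequence
`y_λ(α) = y(α)` (`|α| ≤ 2`), `y(α) + S(α)` (`|α| = 3`), `λ·y(α)` (`|α| ≥ 4`) is again strictly
positive in degree `4`. This is the realizability input of the order-3 surgery: the third moments
of a strictly positive order-4 functional are free once the fourth moments are inflated.
[folklore] -/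
theorem exists_forall_le_isStrictlyKPositive_shift :
    ∀ (n : ℕ) (y S : (Fin n →₀ ℕ) → ℝ), Literature.MeasureTheory.Moments.IsStrictlyKPositive
      (Set.univ : Set (Fin n → ℝ)) 4 y → ∃ Λ₀ : ℝ, ∀ Λ : ℝ, Λ₀ ≤ Λ →
      Literature.MeasureTheory.Moments.IsStrictlyKPositive (Set.univ : Set (Fin n → ℝ)) 4 (fun α =>
      if α.degree ≤ 2 then y α else if α.degree = 3 then y α + S α else Λ * y α) := by
  intro n y S hy
  classical
  by_contra hcon
  push Not at hcon
  obtain ⟨T, hT⟩ := exists_finset_degree_le n 4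
  have hTdeg : ∀ α : ↥T, α.1.degree ≤ 4 := fun α =>
    (finsupp_degree_eq_sum α.1).trans_le ((hT α.1).mp α.2)
  have hTle : ∀ α ∈ T, (α.sum fun _ e => e) ≤ 4 := fun α hα => (hT α).mp hα
  -- fixed vectors of the coefficient space `T → ℝ`
  set w₂ : ↥T → ℝ := fun α => if α.1.degree ≤ 2 then y α.1 else 0 with hw₂
  set w₃ : ↥T → ℝ := fun α => if α.1.degree = 3 then y α.1 + S α.1 else 0 with hw₃
  set w₄ : ↥T → ℝ := fun α => if α.1.degree = 4 then y α.1 else 0 with hw₄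
  set M : ℝ := ∑ α : ↥T, (|w₂ α| + |w₃ α|) with hM
  have hM0 : 0 ≤ M := Finset.sum_nonneg fun α _ => by positivity
  -- decomposition of `L_{y_λ}` on coefficient vectors
  have hdecomp : ∀ (Λ : ℝ) (c : ↥T → ℝ),
      rieszFunctional (fun α => if α.degree ≤ 2 then y α else
        if α.degree = 3 then y α + S α else Λ * y α) (∑ α : ↥T, monomial α.1 (c α)) =
      c ⬝ᵥ w₂ + c ⬝ᵥ w₃ + Λ * (c ⬝ᵥ w₄) := by
    intro Λ c
    unfold rieszFunctional
    rw [riesz_sum_monomial]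
    simp only [dotProduct, hw₂, hw₃, hw₄, Finset.mul_sum, ← Finset.sum_add_distrib]
    refine Finset.sum_congr rfl fun α _ => ?_
    have := hTdeg α
    split_ifs <;> first | omega | ring
  -- the bound `-(c ⬝ w₂ + c ⬝ w₃) ≤ M` on the unit sphere
  have hbound : ∀ c : ↥T → ℝ, ‖c‖ = 1 → -(c ⬝ᵥ w₂ + c ⬝ᵥ w₃) ≤ M := by
    intro c hc
    rw [dotProduct, dotProduct, ← Finset.sum_add_distrib, hM, ← Finset.sum_neg_distrib]
    refine Finset.sum_le_sum fun α _ => ?_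
    have hcα : |c α| ≤ 1 := by
      have := norm_le_pi_norm c α
      rwa [hc, Real.norm_eq_abs] at this
    have h2 : |c α * w₂ α| ≤ |w₂ α| := by
      rw [abs_mul]
      exact mul_le_of_le_one_left (abs_nonneg _) hcα
    have h3 : |c α * w₃ α| ≤ |w₃ α| := by
      rw [abs_mul]
      exact mul_le_of_le_one_left (abs_nonneg _) hcα
    linarith [neg_abs_le (c α * w₂ α), neg_abs_le (c α * w₃ α)]
  -- Step A: failing unit coefficient vectors for arbitrarily large `λ`
  have key : ∀ k : ℕ, ∃ Λ : ℝ, (k : ℝ) + 1 ≤ Λ ∧ ∃ c : ↥T → ℝ, ‖c‖ = 1 ∧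
      (∀ x : Fin n → ℝ, 0 ≤ c ⬝ᵥ fun α : ↥T => ∏ i, x i ^ (α.1 i)) ∧
      c ⬝ᵥ w₂ + c ⬝ᵥ w₃ + Λ * (c ⬝ᵥ w₄) ≤ 0 := by
    intro k
    obtain ⟨Λ, hΛ, hns⟩ := hcon ((k : ℝ) + 1)
    refine ⟨Λ, hΛ, ?_⟩
    have hex : ∃ p : MvPolynomial (Fin n) ℝ, p.totalDegree ≤ 4 ∧ (∀ x, 0 ≤ eval x p) ∧
        (∃ x, eval x p ≠ 0) ∧ rieszFunctional (fun α => if α.degree ≤ 2 then y α else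
          if α.degree = 3 then y α + S α else Λ * y α) p ≤ 0 := by
      by_contra hall
      push Not at hall
      exact hns (isStrictlyKPositive_univ_of fun p h1 h2 h3 => hall p h1 h2 h3)
    obtain ⟨p, hdeg, hnn, ⟨x₀, hx₀⟩, hL⟩ := hex
    set c₀ : ↥T → ℝ := fun α => p.coeff α.1 with hc₀
    have hpc : ∑ α : ↥T, monomial α.1 (c₀ α) = p := by
      refine MvPolynomial.ext _ _ fun β => ?_
      rw [coeff_sum_monomial]
      split_ifs with hβ
      · rfl
      · symm
        rw [← notMem_support_iff]
        intro hβs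
        exact hβ ((hT β).mpr ((le_totalDegree hβs).trans hdeg))
    have hc₀ne : c₀ ≠ 0 := by
      intro h0
      apply hx₀
      rw [← hpc, h0]
      simp
    have hn : 0 < ‖c₀‖ := norm_pos_iff.mpr hc₀ne
    refine ⟨‖c₀‖⁻¹ • c₀, ?_, fun x => ?_, ?_⟩
    · rw [norm_smul, norm_inv, norm_norm, inv_mul_cancel₀ hn.ne']
    · rw [smul_dotProduct, smul_eq_mul]
      refine mul_nonneg (inv_nonneg.mpr hn.le) ?_
      rw [← eval_sum_monomial, hpc]
      exact hnn x
    · have h := hdecomp Λ c₀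
      rw [hpc] at h
      simp only [smul_dotProduct, smul_eq_mul]
      have : ‖c₀‖⁻¹ * (c₀ ⬝ᵥ w₂ + c₀ ⬝ᵥ w₃ + Λ * (c₀ ⬝ᵥ w₄)) ≤ 0 :=
        mul_nonpos_of_nonneg_of_nonpos (inv_nonneg.mpr hn.le) (h ▸ hL)
      nlinarith [this]
  choose lam hlam cs hcs1 hcsnn hcsle using key
  -- Step B: a convergent subsequence on the unit sphere
  obtain ⟨cstar, hmem, φ, hφ, hlim⟩ := (isCompact_sphere (0 : ↥T → ℝ) 1).tendsto_subseq
    (x := cs) fun k => mem_sphere_zero_iff_norm.mpr (hcs1 k)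
  have hcstar1 : ‖cstar‖ = 1 := mem_sphere_zero_iff_norm.mp hmem
  have hcont : ∀ v : ↥T → ℝ, Tendsto (fun k => cs (φ k) ⬝ᵥ v) atTop (𝓝 (cstar ⬝ᵥ v)) := fun v =>
    ((continuous_id.dotProduct continuous_const).tendsto cstar).comp hlim
  -- Step C: limits
  have hnnstar : ∀ x : Fin n → ℝ, 0 ≤ cstar ⬝ᵥ fun α : ↥T => ∏ i, x i ^ (α.1 i) := fun x =>
    ge_of_tendsto' (hcont _) fun k => hcsnn (φ k) x
  have h4nn : ∀ k, 0 ≤ cs k ⬝ᵥ w₄ := by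
    intro k
    have hq := hy.1 (∑ α : ↥T, monomial α.1 (if α.1.degree = 4 then cs k α else 0))
      (totalDegree_sum_monomial_le hTle _) fun x _ => by
        rw [eval_sum_monomial]
        exact degFour_nonneg hTdeg (cs k) (hcsnn k) x
    unfold rieszFunctional at hq
    rw [riesz_sum_monomial] at hq
    convert hq using 1
    simp only [dotProduct, hw₄]
    refine Finset.sum_congr rfl fun α _ => ?_
    split_ifs <;> simp
  have hlampos : ∀ k, 0 < lam k := fun k => by linarith [hlam k, (Nat.cast_nonneg k : (0 : ℝ) ≤ k)]
  have h4le : ∀ k, cs k ⬝ᵥ w₄ ≤ M / ((k : ℝ) + 1) := by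
    intro k
    have h1 : lam k * (cs k ⬝ᵥ w₄) ≤ M := by linarith [hcsle k, hbound (cs k) (hcs1 k)]
    rw [le_div_iff₀ (by positivity)]
    calc cs k ⬝ᵥ w₄ * ((k : ℝ) + 1) ≤ cs k ⬝ᵥ w₄ * lam k :=
          mul_le_mul_of_nonneg_left (hlam k) (h4nn k)
      _ ≤ M := by rw [mul_comm]; exact h1
  have hseq : Tendsto (fun k : ℕ => M / ((k : ℝ) + 1)) atTop (𝓝 0) := by
    have h := (tendsto_one_div_add_atTop_nhds_zero_nat).const_mul M
    rw [mul_zero] at h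
    refine h.congr fun k => ?_
    rw [mul_one_div]
  have h4star : cstar ⬝ᵥ w₄ = 0 := by
    refine tendsto_nhds_unique (hcont w₄) ?_
    refine squeeze_zero (fun k => h4nn (φ k)) (fun k => (h4le (φ k)).trans ?_) hseq
    have hk : (k : ℝ) + 1 ≤ (φ k : ℝ) + 1 := by
      have := Nat.cast_le (α := ℝ).mpr (hφ.id_le k)
      simpa using this
    exact div_le_div_of_nonneg_left hM0 (by positivity) hk
  have h23 : cstar ⬝ᵥ w₂ + cstar ⬝ᵥ w₃ ≤ 0 := by
    refine le_of_tendsto' ((hcont w₂).add (hcont w₃)) fun k => ?_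
    have := hcsle (φ k)
    nlinarith [h4nn (φ k), hlampos (φ k)]
  -- Step D: the quartic part of the limit vanishes
  have hD : ∀ α : ↥T, α.1.degree = 4 → cstar α = 0 := by
    set c4 : ↥T → ℝ := fun α => if α.1.degree = 4 then cstar α else 0 with hc4
    have hc4nn : ∀ x : Fin n → ℝ, 0 ≤ eval x (∑ α : ↥T, monomial α.1 (c4 α)) := fun x => by
      rw [eval_sum_monomial]
      exact degFour_nonneg hTdeg cstar hnnstar x
    have hriesz : rieszFunctional y (∑ α : ↥T, monomial α.1 (c4 α)) = 0 := by
      unfold rieszFunctional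
      rw [riesz_sum_monomial, ← h4star]
      simp only [dotProduct, hw₄, hc4]
      refine Finset.sum_congr rfl fun α _ => ?_
      split_ifs <;> simp
    have hzero : ∑ α : ↥T, monomial α.1 (c4 α) = 0 := by
      by_contra hne
      have hex : ∃ x ∈ (Set.univ : Set (Fin n → ℝ)),
          eval x (∑ α : ↥T, monomial α.1 (c4 α)) ≠ 0 := by
        by_contra hall
        push Not at hall
        exact hne (MvPolynomial.funext fun x => by rw [hall x (Set.mem_univ x), map_zero])
      have := hy.2 _ (totalDegree_sum_monomial_le hTle _) (fun x _ => hc4nn x) hex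
      rw [hriesz] at this
      exact lt_irrefl _ this
    intro α hα
    have := congr_fun (eq_zero_of_sum_monomial_eq_zero hzero) α
    simpa [hc4, hα] using this
  -- Step E: the cubic part of the limit vanishes
  have hE : ∀ α : ↥T, α.1.degree = 3 → cstar α = 0 := by
    set c3 : ↥T → ℝ := fun α => if α.1.degree = 3 then cstar α else 0 with hc3
    have hzero : ∑ α : ↥T, monomial α.1 (c3 α) = 0 :=
      MvPolynomial.funext fun x => by
        rw [eval_sum_monomial, map_zero]
        exact degThree_eq_zero hTdeg cstar hnnstar hD x
    intro α hα
    have := congr_fun (eq_zero_of_sum_monomial_eq_zero hzero) α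
    simpa [hc3, hα] using this
  -- Step F: contradiction with strict positivity of `L_y` at the limit
  have hriesz : rieszFunctional y (∑ α : ↥T, monomial α.1 (cstar α)) =
      cstar ⬝ᵥ w₂ + cstar ⬝ᵥ w₃ := by
    unfold rieszFunctional
    rw [riesz_sum_monomial]
    simp only [dotProduct, hw₂, hw₃, ← Finset.sum_add_distrib]
    refine Finset.sum_congr rfl fun α _ => ?_
    by_cases h2 : α.1.degree ≤ 2
    · have h3 : ¬ α.1.degree = 3 := by omega
      simp [h2, h3]
    · by_cases h3 : α.1.degree = 3
      · simp [hE α h3]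
      · have h4 : α.1.degree = 4 := by
          have := hTdeg α
          omega
        simp [hD α h4]
  have hne : ∑ α : ↥T, monomial α.1 (cstar α) ≠ 0 := by
    intro h0
    have := eq_zero_of_sum_monomial_eq_zero h0
    rw [this, norm_zero] at hcstar1
    exact zero_ne_one hcstar1
  have hex : ∃ x ∈ (Set.univ : Set (Fin n → ℝ)), eval x (∑ α : ↥T, monomial α.1 (cstar α)) ≠ 0 := by
    by_contra hall
    push Not at hall
    exact hne (MvPolynomial.funext fun x => by rw [hall x (Set.mem_univ x), map_zero])
  have hpos := hy.2 _ (totalDegree_sum_monomial_le hTle _)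
    (fun x _ => by rw [eval_sum_monomial]; exact hnnstar x) hex
  rw [hriesz] at hpos
  linarith

end Summit.AnomalousDissipation.AnomalousDissipation.Theorems.MomentParityQuarticGate
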